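import Summits.HodgeConjecture.HodgeConjecture.Theorems.R90S10FrozenDatumDefs               -- ★ C2: `GArch`, `HArch`, `ArchOrbFamG`, `ArchOrbFamH` (reducible; = `GInf`, `HInf`, Borel orbit quotients)
import Summits.HodgeConjecture.HodgeConjecture.Theorems.R90S10ArchFamiliesOfT2Frame          -- ★ p05 (g0) DEAL #46: `exists_archFrame_T2` (hE conjuncts (1)(2)(3) = T2's `hW hC hWH`)
import Summits.HodgeConjecture.HodgeConjecture.Theorems.R90S10ArchDeltaPPNondegenerate       -- ★ p865201 (this seat, DEAL #87 brick): `isArchNondegenerate_archDeltaPP` (hE conjunct (4) = `hnd`)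
import Summits.HodgeConjecture.HodgeConjecture.Theorems.R90S10ArchShelstadQSLetterDefs       -- ★ p865296 (this seat, DEAL #87 (R38) letter): `ArchShelstadQSLetter L μ` + `archShelstadQSLetter_iff` (hE conjunct (5) = `h5`, the residual)
import Literature.NumberTheory.Automorphic.UnitaryGroupArchUnimodular                        -- ★ `UnitaryGroup.modularCharacterFun_arch_antidiagOne_eq_one`, `…_arch_endoscopic_eq_one` (`G_∞`, `H_∞` unimodular)
import Literature.NumberTheory.Automorphic.GLnAdelicIntegrationFactsProofs                   -- ★ `isMulRightInvariant_of_modularCharacterFun_eq_one`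
import Literature.NumberTheory.Automorphic.QuadraticHeckeCharacterCM                           -- ★ `quadraticHeckeCharCM` (the μ-guard of hE)
import HarnessLib

/-!
# R90-TF · S10 (Rogawski 1990 §13.8) · THEOREMS — `R90S10ArchFamiliesJR6LEOfS2`: the PAYER of the A ED. 10 sub-socket `sock_S10_archFamiliesJR6LE` (class L-E′)
# modulo ONE named letter — `archFamiliesJR6LE_of_letters (hShelQS : ∀ L μ, ArchShelstadQSLetter L μ) : ‹★ p864804 `realiseH₂_of_letters`' binder `hE` :88–:105, VERBATIM›`

Cell hodgecm-mathlib, slab R90-TF, section S10 = §13.8, crux item h413 = stmt-HodgeConjecture-24833 (route `route-HodgeConjecture-HCCMUnconditional`).  Prover seat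
K2E5-p16 (g9), DEAL #87 of the S10 dealer R90-C138-plan (g4) (2026-09-05T03:35:40Z) «CENSUS-THEN-PAYER for the NEW A ED. 10 sub-socket `sock_S10_archFamiliesJR6LE :
‹★ p864804 hE :88–:105›» — census `K2/K2E5-p16/g9/CENSUS-DEAL87-JR6LE.md` (d99cb92a7d9d47db).

WHAT `hE` SAYS (print §13.8 p. 218 with §4.3 (4.3.1) p. 43, §1.7 p. 6, §4.9 pp. 54–55, §14.3 p. 234): for every CM field `L` and unitary Hecke character `μ` with
`μ|_{𝕀_{L⁺}} = ω_{L∕L⁺}` there is an ARCHIMEDEAN MEASURE FRAME at the quasi-split pair `(G_∞, H_∞) = (U(Φ₃), U(Φ₂) × U(Φ₁))(L⁺ ⊗ ℝ)` — Haar measures `νGi`, `νHi`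
(right-invariant), centraliser measures `tGi`, `tHi`, orbital measure families `mGi`, `mHi` — with (1) the Weil form `mGi = dνGi ∕ dtGi` at the regular classes,
(2) `tGi` transported under stable conjugacy inside `G_∞`, (3) ★ `ArchCompatibleFamiliesH L νHi mHi tHi tGi`, AND (4) print's factor `Δ″_∞ = archDeltaPP L μ` is
non-degenerate, AND (5) Shelstad's archimedean `Δ″_∞`-transfer `C_c^∞(G_∞) → C_c^∞(H_∞)` exists for these families.

HOW IT IS PAID.  ∃-frame: Mathlib's `haar` on `G_∞`, `H_∞` (binder-supplied Borel σ-algebras), right-invariant because both groups are unimodular (★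
`modularCharacterFun_arch_antidiagOne_eq_one`, ★ `modularCharacterFun_arch_endoscopic_eq_one`, ★ `isMulRightInvariant_of_modularCharacterFun_eq_one`); (1)(2)(3): ★
`exists_archFrame_T2 L haar haar` (its bytes ARE hE's under the reducible J-R6 identification `GArch = GInf`, `ArchOrbFamG L = @OrbitalMeasureFamily (GInf L) _
(fun _ => borel _)`, p05's CENSUS-JR6 (J-R6-a)); (4): ★ `isArchNondegenerate_archDeltaPP L μ` (this seat's brick: the ★ N2∞ eigenline argument reads anisotropy
only as `det H′ ≠ 0`, true at `Φ₃`); (5): the ONE RESIDUAL LETTER `hShelQS : ∀ L μ, ArchShelstadQSLetter L μ` (★ Defs `R90S10ArchShelstadQSLetterDefs`, read through its `Iff.rfl` guard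
`archShelstadQSLetter_iff`) — Literature N3 `ArchEndoscopicTransferCompatible`'s sentence AT `H′ := Φ₃` with its anisotropy guard dropped and `G′ = G` (all tokens hE's own): «for every frame (1)(2)(3) at Haar right-invariant `νGi`, `νHi`, the `Δ″_∞`-transfer exists on `C_c^∞`».
WHY A LETTER: no tree sentence concludes `IsArchDeltaTransferExists … (phi3 L) …` — S2's T2 (`stub_R90_S2_archBlockPacketCusp` :110) and its ★ consumers BIND it,
S6's floor `SockS6ExtArchTransferShelstad` conjunct 2 is guarded `hherm → ∀ hanis, …` hence vacuous at the isotropic `Φ₃`, and ★ `ArchEndoscopicTransferExists` ∕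
`ArchTransfersExist` carry the same guard (census § (5)); the in-house N9″ road runs over `Matrix.diagonal α` under `hanis` (E5-class refit `hanis ↦ α_i ≠ 0`, S6∕LH's
call).  [Rogawski1990 Prop. 4.9.1 (a) p. 55 (archimedean case «a special case of the results of Shelstad»); §14.3 p. 234 «if `v ∈ S₀` the existence of `f_v^H` follows
from results of Shelstad, … Clozel–Delorme … compact support»; Shelstad1982; ClozelDelorme1984 Thm. 1; ArthurClozel1989 Ch. 1 Lemma 7.3 (i).]

CONTENTS (theorems only; no `def`, no `instance`, no `notation`, no `sorry`; axioms ⊆ {propext, Classical.choice, Quot.sound}).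
* `isMulRightInvariant_haar_GArch`, `isMulRightInvariant_haar_HArch` — Mathlib's `haar` on `G_∞`, `H_∞` is right-invariant (unimodularity, ★ by name).
* `archFamiliesJR6LE_of_letters (hShelQS : ∀ L μ, ArchShelstadQSLetter L μ) : ‹hE VERBATIM›` — THE PAYER; residual list of `sock_S10_archFamiliesJR6LE` after it =
  the classed sub-socket `sock_S10_archShelstadQS : ∀ (L : Type) [Field L] [NumberField L] [IsCMField L] (μ : HeckeCharacter L), ArchShelstadQSLetter L μ` ONLY.

HONEST LABEL: count-neutral helper (`--supports stmt-HodgeConjecture-24833`); it pays `sock_S10_archFamiliesJR6LE` only MODULO the named letter `hShelQS` (Shelstad's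
quasi-split archimedean endoscopic transfer — a printed citation, E5-class, not proved in the tree).  HC_CM is proved only modulo the 7 printed citations (2 remaining
named inputs: hLiu418 = stmt-HodgeConjecture-24832, h413 = stmt-HodgeConjecture-24833) until rung 0 closes; REL ≠ ★ ≠ BUILT.
Namespace `Summit.HodgeConjecture.HodgeConjecture.R90.S10`.

## References
* [Rogawski1990] J. D. Rogawski, *Automorphic Representations of Unitary Groups in Three Variables*, Ann. of Math. Stud. 123 (1990): §1.7 p. 6; §4.3 (4.3.1) p. 43;
  §4.9 pp. 54–55, Prop. 4.9.1 (a) p. 55; §13.8 p. 218; §14.2 (14.2.1) pp. 232–233; §14.3 pp. 233–234.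
* [Shelstad1982] D. Shelstad, *L-indistinguishability for real groups*, Math. Ann. 259 (1982).
* [ClozelDelorme1984] L. Clozel, P. Delorme, *Le théorème de Paley–Wiener invariant pour les groupes de Lie réductifs*, Invent. Math. 77 (1984), Thm. 1.
* [ArthurClozel1989] J. Arthur, L. Clozel, *Simple Algebras, Base Change, and the Advanced Theory of the Trace Formula*, Ann. of Math. Stud. 120 (1989), Ch. 1 Lemma 7.3 (i).
* [Knapp2002] A. W. Knapp, *Lie Groups Beyond an Introduction*, 2nd ed. (2002), VIII §2 Cor. 8.31 (reductive groups are unimodular).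
-/

set_option autoImplicit false
-- the mandated namespace repeats the single-problem summit's segment (`HodgeConjecture.HodgeConjecture`)
set_option linter.dupNamespace false

noncomputable section

open NumberField MeasureTheory MeasureTheory.Measure
open scoped Matrix MatrixGroups
open Literature.NumberTheory.Automorphic Literature.NumberTheory.Rogawski1990 Literature.NumberTheory.GaloisRepresentations

namespace Summit.HodgeConjecture.HodgeConjecture.R90.S10

/-! ## §1 The ∃-frame's Haar measures are right-invariant (`G_∞`, `H_∞` unimodular) -/

/-- **Mathlib's Haar measure on `G_∞ = U(Φ₃)(L⁺ ⊗ ℝ)` is right-invariant** (the group is unimodular: ★ `UnitaryGroup.modularCharacterFun_arch_antidiagOne_eq_one`),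
for any Borel σ-algebra supplied by the binder. [cite: Knapp2002, VIII §2 Cor. 8.31] [cite: Rogawski1990, §14.2 (14.2.1) p. 232] -/
theorem isMulRightInvariant_haar_GArch (L : Type) [Field L] [NumberField L] [IsCMField L] [MeasurableSpace (GArch L)] [BorelSpace (GArch L)] :
    (haar : Measure (GArch L)).IsMulRightInvariant :=
  isMulRightInvariant_of_modularCharacterFun_eq_one (UnitaryGroup.modularCharacterFun_arch_antidiagOne_eq_one L 3) _

/-- **Mathlib's Haar measure on `H_∞ = (U(Φ₂) × U(Φ₁))(L⁺ ⊗ ℝ)` is right-invariant** (★ `UnitaryGroup.modularCharacterFun_arch_endoscopic_eq_one`), for any Borel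
σ-algebra supplied by the binder. [cite: Knapp2002, VIII §2 Cor. 8.31] [cite: Rogawski1990, §14.3 p. 234] -/
theorem isMulRightInvariant_haar_HArch (L : Type) [Field L] [NumberField L] [IsCMField L] [MeasurableSpace (HArch L)] [BorelSpace (HArch L)] :
    (haar : Measure (HArch L)).IsMulRightInvariant :=
  isMulRightInvariant_of_modularCharacterFun_eq_one (UnitaryGroup.modularCharacterFun_arch_endoscopic_eq_one L) _

/-! ## §2 The payer of `sock_S10_archFamiliesJR6LE` modulo the letter `hShelQS` -/

/-- **L-E′ PAID MODULO SHELSTAD'S QUASI-SPLIT ARCHIMEDEAN TRANSFER** — the conclusion is ★ p864804 `realiseH₂_of_letters`' binder `hE` :88–:105 VERBATIM (= the type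
of the A ED. 10 sub-socket `sock_S10_archFamiliesJR6LE`); the hypothesis `hShelQS : ∀ L μ, ArchShelstadQSLetter L μ` (★ letter Defs) is Literature N3
`ArchEndoscopicTransferCompatible`'s sentence at `H′ := Φ₃` with the anisotropy guard dropped and `G′ = G`: for every CM `L`, unitary `μ` with `μ|_{𝕀_{L⁺}} = ω_{L∕L⁺}`, Haar right-invariant `νGi`, `νHi`, and every frame `(tGi, tHi, mGi, mHi)`
with (1) Weil form, (2) stable transport, (3) ★ `ArchCompatibleFamiliesH`, the `Δ″_∞`-transfer `C_c^∞(G_∞) → C_c^∞(H_∞)` exists (★ `IsArchDeltaTransferExists`).  Proof: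
`νGi := haar`, `νHi := haar` (§1), frame ★ `exists_archFrame_T2`, (4) ★ `isArchNondegenerate_archDeltaPP`, (5) `hShelQS` at that frame.
[cite: Rogawski1990, §13.8 p. 218; §4.3 (4.3.1) p. 43; §4.9 Prop. 4.9.1 (a) p. 55; §14.3 p. 234] [cite: Shelstad1982] [cite: ClozelDelorme1984, Thm. 1]
[cite: ArthurClozel1989, Ch. 1 Lemma 7.3 (i)] -/
theorem archFamiliesJR6LE_of_letters
    (hShelQS : ∀ (L : Type) [Field L] [NumberField L] [IsCMField L] (μ : HeckeCharacter L), ArchShelstadQSLetter L μ) :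
    ∀ (L : Type) [Field L] [NumberField L] [IsCMField L] (μ : HeckeCharacter L)
      [MeasurableSpace (GArch L)] [BorelSpace (GArch L)] [MeasurableSpace (HArch L)] [BorelSpace (HArch L)],
      μ.IsUnitary →
      (∀ x : Literature.NumberTheory.GaloisRepresentations.ideleGroup ↥(maximalRealSubfield L),
        μ (AdeleRing.ideleBaseChange (↥(maximalRealSubfield L)) L x) = quadraticHeckeCharCM L x) →
      ∃ (νGi : Measure (GArch L)) (_ : νGi.IsHaarMeasure) (_ : νGi.IsMulRightInvariant) (νHi : Measure (HArch L)) (_ : νHi.IsHaarMeasure) (_ : νHi.IsMulRightInvariant) (tGi : ∀ γ : GArch L, Measure (Subgroup.centralizer ({γ} : Set (GArch L)))) (tHi : ∀ a : HArch L, Measure (Subgroup.centralizer ({a} : Set (HArch L)))) (mGi : ArchOrbFamG L) (mHi : ArchOrbFamH L),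
        (letI : ∀ γ : GArch L, MeasurableSpace (GArch L ⧸ Subgroup.centralizer ({γ} : Set (GArch L))) := fun _ => borel _
    haveI : ∀ γ : GArch L, BorelSpace (GArch L ⧸ Subgroup.centralizer ({γ} : Set (GArch L))) := fun _ => ⟨rfl⟩
    mGi.IsQuotientOf (fun γ => IsRegularElt (γ.val : GL (Fin 3) (mixedEmbedding.mixedSpace L))) νGi tGi) ∧
        (∀ (γ₁ γ₂ : GArch L)
            (h₁ : IsRegularElt (γ₁.val : GL (Fin 3) (mixedEmbedding.mixedSpace L)))
            (hc : Corresponds (UnitaryGroup.conjMixed (↥(maximalRealSubfield L)) L (IsCMField.complexConj L))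
              (UnitaryGroup.archFormOf L 3 (phi3 L)) (UnitaryGroup.archFormOf L 3 (phi3 L)) γ₁ γ₂),
            Measure.map ⇑(UnitaryGroup.archStableCentralizerEquiv L (UnitaryGroup.isUnit_antidiagOne_det L 3).ne_zero
              (UnitaryGroup.isUnit_antidiagOne_det L 3).ne_zero hc h₁) (tGi γ₁) = tGi γ₂) ∧
        ArchCompatibleFamiliesH L νHi mHi tHi tGi ∧
        IsArchNondegenerate L (phi3 L) (archDeltaPP L μ) ∧
        IsArchDeltaTransferExists L (phi3 L) (archDeltaPP L μ) mHi mGi (ArchSmooth L 3 (phi3 L)) (ArchSmooth₂ L) := by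
  intro L _ _ _ μ _ _ _ _ hμu hμω
  haveI hG : (haar : Measure (GArch L)).IsMulRightInvariant := isMulRightInvariant_haar_GArch L
  haveI hH : (haar : Measure (HArch L)).IsMulRightInvariant := isMulRightInvariant_haar_HArch L
  obtain ⟨mH, mG, tH, t, hW, hC, hWH⟩ := exists_archFrame_T2 L (haar : Measure (GArch L)) (haar : Measure (HArch L))
  exact ⟨haar, inferInstance, hG, haar, inferInstance, hH, t, tH, mG, mH, hW, hC, hWH, isArchNondegenerate_archDeltaPP L μ,
    (archShelstadQSLetter_iff L μ).1 (hShelQS L μ) hμu hμω haar haar t tH mG mH hW hC hWH⟩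

end Summit.HodgeConjecture.HodgeConjecture.R90.S10

end
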